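/-
COR-CM (cell pub-hodgecm2, stage 2 of the Hodge ladder) — Δ2 BRIDGE, X1 (J) pin, piece **(J2) «ALBANESE ON COMPONENTS»**, the
COMPLEX-POINTS HALF OF THE PIN: for Deligne's canonical model `M_K` of the compact unitary Shimura surface (a `RecordSystem`, named
fact `exists_recordSystem`), EVERY index `h ∈ U(H)(𝔸_{L⁺,f})` — not only the chosen representatives `g_q` of the record's `pieces` —
carries a component morphism `Y ⟶ (M_K)_τ` from ANY ball quotient `Y` of the natural level `Γ_H(hKh⁻¹)`, pinned on complex points by
`[v] ↦ [v, hK]`; such morphisms are UNIQUE (complex points separate morphisms into the separated `(M_K)_τ`), hence COHERENT: along a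
rational translate (`h' ∈ γ h K`), along the transition morphisms `M_K → M_{K'}` and along the Hecke translates `T_g`.  Seat
prover-pub-hodgecm2-d2bridge-prove-5-g0-0 (unit pub-hodgecm2-d2bridge-prove-5, SEAT ASK OPS-REQUESTS l. 377).  THEOREMS ONLY, Literature
imports only (no `HodgeCM.Model.*`, no manifest path); nothing landed is edited or restated.  FRAMING: HC_CM is NOT proved; «Δ2 BRIDGE
CLOSED» is NOT claimed.
-/
import Literature.AlgebraicGeometry.ShimuraVarieties.UnitaryShimuraHeckeComplex
import Literature.AlgebraicGeometry.ShimuraVarieties.UnitaryShimuraCanonicalModelHecke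
import HarnessLib

/-!
# Δ2 bridge, (J2) pin, points half: component morphisms `Y ⟶ (M_K)_τ` at EVERY index `h`, and their coherence

[Deligne1979ShimuraVarieties] 2.1.2: `M_ℂ` is «a disjoint sum, indexed by `G(ℚ)\G(𝔸^f)/K`, of the quotients `Γ_g\X⁺`», `Γ_g = gKg⁻¹ ∩ G(ℚ)`;
2.1.4: the transition morphisms; [Milne2005ShimuraVarieties] Lemma 5.13 p. 57 (`[x] ↦ [x, g]`), §13 p. 118 L21–26 («`T(g) : [x, aK] ↦
[x, agK′]`»).  The record `UnitaryCanonicalModel.RecordSystem` carries the complex points `pts_K : M_K(ℂ) ≃ₜ Sh_K(ℂ)` (F2a), the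
transitions on points `map_pts` (2.1.4) and the `pieces` (F2c): a cofan of ball quotients `X_q` over representatives `g_q`, uniformised by
`z ↦ [z, g_qK]`.  The tower of the Δ2 bridge (`HodgeCM/Model/TowerLevel`) indexes components by ALL `h ∈ U(V)(𝔸_f)` (levels `Γ.conj h`);
this file supplies the morphisms it needs, at the Literature level of the record:

* §0 `exists_ball_smul_of_mem_negCone` (the negative cone is `ℂˣ · T·lift(𝔹²)` in the frame `T`), `AlgPoints.baseChangeEquiv_map`
  (naturality of `X(ℂ) ≃ X_τ(ℂ)`), `hom_ext_of_frame` (two morphisms out of a ball quotient of `H^τ` into a separated `ℂ`-scheme agreeing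
  on the points `[T·lift x]` are equal — tree `SchemeOver.hom_ext_of_forall_algPoints`).
* §1 `RecordSystem.exists_componentMap` — for a level `K ≤ K₀`, an index `h` and a ball-uniformised smooth projective `Y` with datum `D`,
  `D.Hℂ = H^τ`, `D.Γ^{τ₁} = Γ_H(hKh⁻¹)^τ`: `∃ inj : Y ⟶ (M_K)_τ` with `inj [T·lift x] = [x, hK]` for all `x ∈ 𝔹²`.  KERNEL: the record's
  `pieces` at the class `q = [h]`, a rational `γ` with `hK = γ⁻¹ g_q K` (`exists_rational_rep`), the ball-quotient translation `[v] ↦ [γ^τ v]`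
  `Y ⟶ X_q` (`UnitaryBallHeckeTranslation.exists_hom_map_unif_mulVec_eq_of_nonempty`, Arapura Cor. 15.4.6 = tree theorem; level condition
  `conj_arithmeticLevel_le`), then the cofan leg `ι_q` — token for token the one-piece case of the tree's `RecordSystem.exists_heckeComplex`.
* §2 COHERENCE (uniqueness `hom_ext_of_frame` + the point formulas): `componentMap_eq_comp_of_rel` (`h' ∈ γ_f h K`: `inj_h = t_γ ≫ inj_{h'}`
  for any translate `t_γ : Y_h ⟶ Y_{h'}`, `[v] ↦ [γ^τ v]`), `componentMap_comp_heckeTranslate` (`inj_h ≫ (T_g)_τ = t_1 ≫ inj_{hg}` at the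
  larger level, for any morphism `T_g` acting as `[z, aK₁] ↦ [z, agK]`, `RecordSystem.IsHeckeTranslate`), `componentMap_comp_map` (the
  transition morphisms, `g = 1`).

The Model-cone consumer (`CorCM/D2Bridge/AlbaneseOnComponents.lean`) takes `Y := P_{Γ_K.conj h}(V)`, `D` its ball datum, `t_γ := transMor`.
No named fact is introduced (a `RecordSystem` is a hypothesis; `arapura2012_cor_15_4_6_holds`, `exists_isReal_hodgeModel_holds` are tree
theorems); no `sorry`.  HC_CM is NOT proved.

## References
* [Deligne1979ShimuraVarieties] P. Deligne, *Variétés de Shimura*, Corvallis 1979, 2.1.2–2.1.4, 2.2.5.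
* [Milne2005ShimuraVarieties] J. S. Milne, *Introduction to Shimura varieties* (2005), Lemma 5.13 p. 57, §13 p. 118 L21–28, Prop. 13.1 p. 117.
* [Arapura2012] D. Arapura, *Algebraic Geometry over the Complex Numbers*, Cor. 15.4.6.
* [MumfordAV1970] D. Mumford, *Abelian Varieties*, §4 (points separate morphisms).
-/

set_option autoImplicit false

noncomputable section

open Function MulAction Topology NumberField IsDedekindDomain CategoryTheory CategoryTheory.Limits Matrix AlgebraicGeometry
open scoped Matrix
open Literature.AlgebraicGeometry.Motives
open Literature.NumberTheory.Automorphic Literature.NumberTheory.Automorphic.UnitaryGroup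
open Literature.NumberTheory.Automorphic.Liu2021.AppendixC (C5.OpenCompactSubgroup C5.SmallLevel)
open Literature.Geometry.ComplexHyperbolic Literature.Geometry.ComplexHyperbolic.BallModel
open Literature.NumberTheory.Automorphic.ShimuraDissection
open Literature.AlgebraicGeometry.HodgeTheory (HodgeModel)
open Literature.NumberTheory.Transcendental (arapura2012_cor_15_4_6_holds)
open Literature.AlgebraicGeometry.ShimuraVarieties Literature.AlgebraicGeometry.ShimuraVarieties.UnitaryCanonicalModel

namespace Summit.HodgeConjecture.CorCM.D2Bridge

/-! ## §0 Three pieces of bookkeeping -/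

section Frame

variable {L : Type} [Field L] [NumberField L] [IsCMField L] {H : Matrix (Fin 3) (Fin 3) L} {τ : L →+* ℂ} {T : GL (Fin 3) ℂ}

omit [NumberField L] [IsCMField L] in
/-- In the frame `T` (`Tᴴ H^τ T = J`) the hermitian square of `T w` is `Q(w)` (as in `UnitaryShimuraComplexFibreGalois`). [folklore] -/
private theorem hermForm_frame_apply (hT : formCongr (starRingEnd ℂ) T (H.map τ) = BallModel.J) (w : Fin 3 → ℂ) :
    hermForm (starRingEnd ℂ) (H.map τ) ((T : Matrix (Fin 3) (Fin 3) ℂ) *ᵥ w) ((T : Matrix (Fin 3) (Fin 3) ℂ) *ᵥ w) =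
      ((Q w : ℝ) : ℂ) := by
  rw [hermForm_starRingEnd, ← form_eq_Q, ← hT, star_mulVec, ← dotProduct_mulVec, mulVec_mulVec, mulVec_mulVec]
  rfl

omit [NumberField L] [IsCMField L] in
/-- **The negative cone of `H^τ` is `ℂˣ · T·lift(𝔹²)`**: every negative vector `v` of `H^τ` is a non-zero multiple of the frame vector
`T·(x, 1)` of a (unique) ball point `x` — `x` = the projection of `T⁻¹ v` (whose `J`-square is `⟨v, v⟩ < 0`).  With the record's clauses,
stated on the vectors `T·lift x`, this makes them statements about ALL complex points of a ball quotient.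
[cite: Milne2005ShimuraVarieties, Lemma 5.13 p. 57] -/
theorem exists_ball_smul_of_mem_negCone (hT : formCongr (starRingEnd ℂ) T (H.map τ) = BallModel.J) {v : Fin 3 → ℂ}
    (hv : v ∈ negCone (H.map τ)) :
    ∃ (x : Ball) (c : ℂ), c ≠ 0 ∧ v = c • ((T : Matrix (Fin 3) (Fin 3) ℂ) *ᵥ BallModel.lift x) := by
  set w : Fin 3 → ℂ := ((T⁻¹ : GL (Fin 3) ℂ) : Matrix (Fin 3) (Fin 3) ℂ) *ᵥ v with hw_def
  have hTw : (T : Matrix (Fin 3) (Fin 3) ℂ) *ᵥ w = v := by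
    rw [hw_def, mulVec_mulVec, ← Units.val_mul, mul_inv_cancel, Units.val_one, one_mulVec]
  have hQ : Q w < 0 := by
    have h := hv
    rw [← hTw, mem_negCone_iff, ← hermForm_starRingEnd, hermForm_frame_apply hT, Complex.ofReal_re] at h
    exact h
  have h2 := BallModel.ne_zero_of_Q_neg hQ
  have hlift : BallModel.lift (proj w hQ) = (w 2)⁻¹ • w := by
    funext k
    fin_cases k
    · simp [BallModel.lift, div_eq_inv_mul]
    · simp [BallModel.lift, div_eq_inv_mul]
    · simp [BallModel.lift, h2]
  refine ⟨proj w hQ, w 2, h2, ?_⟩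
  rw [hlift, mulVec_smul, hTw, smul_smul, mul_inv_cancel₀ h2, one_smul]

omit [NumberField L] [IsCMField L] in
/-- **Complex points separate morphisms out of a ball quotient of `H^τ`**: two morphisms `u, v : Y ⟶ Z` of `ℂ`-schemes out of a smooth
projective surface `Y` uniformised by the negative cone of `H^τ`, into a SEPARATED `Z`, which agree on the points `[T·lift x]`, `x ∈ 𝔹²`, are
equal — every complex point of `Y` is such a point (`surjOn_unif`, `exists_ball_smul_of_mem_negCone`, `unif_smul`), `Y` is reduced and
locally of finite type (smooth over `ℂ`), and `ℂ`-points separate morphisms (tree `SchemeOver.hom_ext_of_forall_algPoints`).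
[cite: MumfordAV1970, §4] [cite: Milne2005ShimuraVarieties, Prop. 13.1 p. 117] -/
theorem hom_ext_of_frame (hT : formCongr (starRingEnd ℂ) T (H.map τ) = BallModel.J) {Y Z : SchemeOver ℂ}
    (D : UnitaryBallUniformisationDatum 2 Y) (hD : D.Hℂ = H.map τ) [IsSeparated Z.hom] {u v : Y ⟶ Z}
    (huv : ∀ x : Ball, AlgPoints.map u (D.unif ((T : Matrix (Fin 3) (Fin 3) ℂ) *ᵥ BallModel.lift x)) =
      AlgPoints.map v (D.unif ((T : Matrix (Fin 3) (Fin 3) ℂ) *ᵥ BallModel.lift x))) : u = v := by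
  haveI := D.isSmoothProjective.smoothOfRelativeDimension
  haveI : Smooth Y.hom := SmoothOfRelativeDimension.smooth 2 Y.hom
  haveI : IsReduced Y.left := isReduced_of_smooth_over_field Y.hom
  refine SchemeOver.hom_ext_of_forall_algPoints ℂ fun P => ?_
  obtain ⟨w, hw, rfl⟩ := D.surjOn_unif (Set.mem_univ P)
  have hw' : w ∈ negCone (H.map τ) := by rw [← hD]; exact hw
  obtain ⟨x, c, hc, rfl⟩ := exists_ball_smul_of_mem_negCone hT hw'
  have hcone : (T : Matrix (Fin 3) (Fin 3) ℂ) *ᵥ BallModel.lift x ∈ D.cone := by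
    change _ ∈ negCone D.Hℂ
    rw [hD]
    exact frame_mulVec_lift_mem_negCone hT x
  rw [D.unif_smul hc hcone]
  simpa only [AlgPoints.map_apply] using huv x

end Frame

section BaseChangePoints

variable {k K : Type} [Field k] [Field K] (σ : k →+* K) {X Y : SchemeOver k} (m : X ⟶ Y)

/-- **Naturality of `X(K) ≃ X_σ(K)`** (`AlgPoints.baseChangeEquiv`, [GortzWedhorn2020] (4.7.1) `Hom_{S'}(T, X_{(S')}) = Hom_S(T, X)`): for a
`k`-morphism `m : X ⟶ Y`, `(m P)_σ = m_σ (P_σ)` — both are the `K`-point of `Y_σ` lying over `P ≫ m` (pullback extensionality).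
[cite: GortzWedhorn2020, §(4.7) eq. (4.7.1)] -/
theorem AlgPoints.baseChangeEquiv_map (P : letI := σ.toAlgebra; AlgPoints X K) :
    AlgPoints.baseChangeEquiv σ Y (letI := σ.toAlgebra; AlgPoints.map m P) =
      AlgPoints.map ((baseChangeHom σ).map m) (AlgPoints.baseChangeEquiv σ X P) := by
  letI := σ.toAlgebra
  apply Over.OverMorphism.ext
  apply pullback.hom_ext
  · change (AlgPoints.baseChangeEquiv σ Y (AlgPoints.map m P)).left ≫ baseChangeHomFst σ Y =
      (AlgPoints.baseChangeEquiv σ X P ≫ (baseChangeHom σ).map m).left ≫ baseChangeHomFst σ Y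
    rw [AlgPoints.baseChangeEquiv_apply_left_comp_fst, Over.comp_left, Category.assoc, baseChangeHom_map_left_comp_fst,
      ← Category.assoc, AlgPoints.baseChangeEquiv_apply_left_comp_fst]
    rfl
  · have h₁ := Over.w (AlgPoints.baseChangeEquiv σ Y (AlgPoints.map m P))
    have h₂ := Over.w (AlgPoints.baseChangeEquiv σ X P ≫ (baseChangeHom σ).map m)
    exact h₁.trans h₂.symm

end BaseChangePoints

/-! ## §1 The component morphism at EVERY index `h` -/

section Record

variable {L : Type} [Field L] [NumberField L] [IsCMField L] {H : Matrix (Fin 3) (Fin 3) L}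
  {τ : L →+* ℂ} {T : GL (Fin 3) ℂ} {hT : formCongr (starRingEnd ℂ) T (H.map τ) = BallModel.J}
  {K₀ : C5.OpenCompactSubgroup ↥(finAdelic (↥(maximalRealSubfield L)) L (IsCMField.complexConj L) 3 H)}

set_option maxHeartbeats 1600000 in -- large adelic / Shimura-set terms: instance-heavy statement (as `RecordSystem.exists_heckeComplex`)
/-- **The component morphism at every index.**  For the record system `S` of Deligne's models, a level `K ≤ K₀`, an index
`h ∈ U(H)(𝔸_{L⁺,f})`, and a smooth projective complex surface `Y` uniformised (datum `D`) by the negative cone of `H^τ` modulo the NATURAL level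
`Γ_H(hKh⁻¹)` (read in `GL₃(ℂ)` through `τ`), there is a morphism `inj : Y ⟶ (M_K)_τ` acting on complex points as `[T·lift x] ↦ [x, hK]`
([Deligne1979ShimuraVarieties] 2.1.2 / [Milne2005ShimuraVarieties] Lemma 5.13: the piece `Γ_h\X⁺ ↪ Sh_K(ℂ)`, `[x] ↦ [x, h]`, FOR ANY `h`).
KERNEL: the record's `pieces` cofan is indexed by representatives `g_q` only; with `q = [h]` and a rational `γ` with `hK = γ⁻¹g_qK`
(`exists_rational_rep`) the translation `[v] ↦ [γ^τ v] : Y ⟶ X_q` is a morphism (`UnitaryBallHeckeTranslation.exists_hom_map_unif_mulVec_eq_of_nonempty`,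
Arapura Cor. 15.4.6 = tree theorem `arapura2012_cor_15_4_6_holds`; `γΓ_H(hKh⁻¹)γ⁻¹ ≤ Γ_H(g_qKg_q⁻¹)`, `conj_arithmeticLevel_le`), and
`inj := (that) ≫ ι_q`; the point formula is `[x, hK] = [γx, g_qK]` and `T·lift(γ•x) ∝ γ^τ T·lift(x)` (`mulVec_frame_lift_ratToU21_smul`).
[cite: Deligne1979ShimuraVarieties, 2.1.2] [cite: Milne2005ShimuraVarieties, Lemma 5.13 p. 57] [cite: Arapura2012, §15.4 Cor. 15.4.6] -/
theorem exists_componentMap (S : RecordSystem L H τ T hT K₀) (K : C5.SmallLevel K₀)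
    (hh : finAdelic (↥(maximalRealSubfield L)) L (IsCMField.complexConj L) 3 H)
    {Y : SchemeOver ℂ} (D : UnitaryBallUniformisationDatum 2 Y) (hY : Nonempty (HodgeModel 2 Y)) (hDH : D.Hℂ = H.map τ)
    (hDΓ : D.Γ.map (Matrix.GeneralLinearGroup.map D.τ₁) =
      (arithmeticLevel (↥(maximalRealSubfield L)) L (IsCMField.complexConj L) 3 H
        (K.1.1.map (MulAut.conj hh).toMonoidHom)).map (Matrix.GeneralLinearGroup.map τ)) :
    letI : Algebra L ℂ := τ.toAlgebra
    ∃ inj : Y ⟶ (baseChangeHom τ).obj (S.M.obj K),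
      ∀ x : Ball, AlgPoints.map inj (D.unif ((T : Matrix (Fin 3) (Fin 3) ℂ) *ᵥ BallModel.lift x)) =
        AlgPoints.baseChangeEquiv τ (S.M.obj K) ((S.pts K).symm (ShimuraSet.mk L H τ T hT K.1.1 x hh)) := by
  letI : Algebra L ℂ := τ.toAlgebra
  classical
  obtain ⟨gq, hgq, X, ι, hcol, B, hB⟩ := S.pieces K
  -- the class `q = [h]` and a rational `γ` with `(φ(γ) h)⁻¹ g_q ∈ K`
  obtain ⟨γ, hγ⟩ := exists_rational_rep hgq hh
  set q : orbitRel.Quotient (rational (↥(maximalRealSubfield L)) L (IsCMField.complexConj L) 3 H)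
      (CosetSpace (rationalToFinAdelic (↥(maximalRealSubfield L)) L (IsCMField.complexConj L) 3 H) K.1.1) :=
    Quotient.mk'' (CosetSpace.pt (rationalToFinAdelic (↥(maximalRealSubfield L)) L (IsCMField.complexConj L) 3 H) K.1.1 hh) with hqdef
  have hHM : Nonempty (HodgeModel 2 (X q)) :=
    let ⟨A, _⟩ := Literature.AlgebraicGeometry.HodgeTheory.exists_isReal_hodgeModel_holds 2 (X q) (B q).isSmoothProjective; ⟨A⟩
  -- the translation `[v] ↦ [γ^τ v] : Y ⟶ X_q`
  have hpiece : ∃ f : Y ⟶ X q, ∀ v ∈ D.cone, AlgPoints.map f (D.unif v) =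
      (B q).unif (((Matrix.GeneralLinearGroup.map τ ((γ : rational _ L _ 3 H) : GL (Fin 3) L) :
        GL (Fin 3) ℂ) : Matrix (Fin 3) (Fin 3) ℂ) *ᵥ v) := by
    obtain ⟨hH2, hΓ2, -⟩ := hB q
    refine UnitaryBallHeckeTranslation.exists_hom_map_unif_mulVec_eq_of_nonempty arapura2012_cor_15_4_6_holds hY hHM ?_ ?_
    · rw [hDH, hH2]
      exact conjTranspose_map_mul_map (τ := τ) γ
    · rw [hDΓ, hΓ2, Subgroup.map_map]
      have hcomm : ((MulAut.conj (Matrix.GeneralLinearGroup.map τ ((γ : rational _ L _ 3 H) : GL (Fin 3) L))).toMonoidHom).comp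
          (Matrix.GeneralLinearGroup.map τ) =
        (Matrix.GeneralLinearGroup.map (n := Fin 3) τ).comp
          (MulAut.conj ((γ : rational _ L _ 3 H) : GL (Fin 3) L)).toMonoidHom := by
        ext δ i j
        simp [MulAut.conj_apply, map_mul, map_inv]
      rw [hcomm, ← Subgroup.map_map]
      apply Subgroup.map_mono
      have hγ' : (rationalToFinAdelic (↥(maximalRealSubfield L)) L (IsCMField.complexConj L) 3 H γ * hh * 1)⁻¹ * gq q ∈ K.1.1 := by
        rw [mul_one]; exact hγ
      exact conj_arithmeticLevel_le (K := K.1.1) (K' := K.1.1) (g := 1) (fun k hk => by simpa using hk) hγ'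
  obtain ⟨f, hf⟩ := hpiece
  refine ⟨f ≫ ι q, fun x => ?_⟩
  -- `[x, hK] = [ρ(γ) • x, g_q K]`
  have hx : ShimuraSet.mk L H τ T hT K.1.1 x hh = ShimuraSet.mk L H τ T hT K.1.1 (ratToU21 L H τ T hT γ • x) (gq q) := by
    refine (ShimuraSet.mk_eq_mk_iff L H τ T hT K.1.1 _ _ _ _).mpr ⟨γ⁻¹, ?_, ?_⟩
    · rw [smul_smul, ← map_mul, inv_mul_cancel, map_one, one_smul]
    · simpa only [map_inv, _root_.mul_inv_rev, mul_assoc] using hγ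
  have hcone : (T : Matrix (Fin 3) (Fin 3) ℂ) *ᵥ BallModel.lift x ∈ D.cone := by
    change _ ∈ negCone D.Hℂ
    rw [hDH]
    exact frame_mulVec_lift_mem_negCone hT x
  have hcone' : (T : Matrix (Fin 3) (Fin 3) ℂ) *ᵥ BallModel.lift (ratToU21 L H τ T hT γ • x) ∈ (B q).cone := by
    change _ ∈ negCone (B q).Hℂ
    rw [(hB q).1]
    exact frame_mulVec_lift_mem_negCone hT _
  obtain ⟨c, hc, hcx⟩ := mulVec_frame_lift_ratToU21_smul (hT := hT) γ x
  rw [hx, AlgPoints.map_comp_apply, hf _ hcone, hcx, (B q).unif_smul hc hcone', (hB q).2.2]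

/-! ## §2 Coherence: rational translates, Hecke translates, transitions -/

/-- The complex fibre `(M_K)_τ` is separated over `ℂ` (base change of the projective, hence proper and separated, `M_K → Spec L`). [folklore] -/
theorem isSeparated_baseChange_record (S : RecordSystem L H τ T hT K₀) (K : C5.SmallLevel K₀) :
    IsSeparated ((baseChangeHom τ).obj (S.M.obj K)).hom := by
  haveI : IsProper (S.M.obj K).hom := (S.projective K).isProper
  change IsSeparated (pullback.snd (S.M.obj K).hom (Spec.map (CommRingCat.ofHom τ)))
  infer_instance

set_option maxHeartbeats 1600000 in -- large adelic / Shimura-set terms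
/-- **Coherence along a rational translate** ([Deligne1979ShimuraVarieties] 2.1.2: the pieces at `h` and at `h' ∈ γ_f h K` are the SAME
component, identified by `z ↦ γz`).  If `h' = γ_f h k` (`k ∈ K`; the tower's relation `TowerLevel.Rel Γ γ h h'`), `inj_h : Y₁ ⟶ (M_K)_τ` and
`inj_{h'} : Y₂ ⟶ (M_K)_τ` are component morphisms at `h`, `h'` (point formulas), and `t : Y₁ ⟶ Y₂` is ANY morphism acting as
`[v] ↦ [γ^τ v]` (at the pin: `transMor γ`), then `inj_h = t ≫ inj_{h'}` ON THE NOSE (uniqueness `hom_ext_of_frame`; `[x, hK] = [γx, h'K]`).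
[cite: Deligne1979ShimuraVarieties, 2.1.2] [cite: Milne2005ShimuraVarieties, Lemma 5.13 p. 57 and Prop. 13.1 p. 117] -/
theorem componentMap_eq_comp_of_rel (S : RecordSystem L H τ T hT K₀) (K : C5.SmallLevel K₀)
    {hh₁ hh₂ : finAdelic (↥(maximalRealSubfield L)) L (IsCMField.complexConj L) 3 H}
    (γ : rational (↥(maximalRealSubfield L)) L (IsCMField.complexConj L) 3 H)
    (hrel : ∃ k ∈ K.1.1, hh₂ = rationalToFinAdelic (↥(maximalRealSubfield L)) L (IsCMField.complexConj L) 3 H γ * hh₁ * k)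
    {Y₁ Y₂ : SchemeOver ℂ} (D₁ : UnitaryBallUniformisationDatum 2 Y₁) (D₂ : UnitaryBallUniformisationDatum 2 Y₂)
    (hD₁ : D₁.Hℂ = H.map τ) (hD₂ : D₂.Hℂ = H.map τ) (t : Y₁ ⟶ Y₂)
    (ht : ∀ v ∈ D₁.cone, AlgPoints.map t (D₁.unif v) =
      D₂.unif (((Matrix.GeneralLinearGroup.map τ ((γ : rational _ L _ 3 H) : GL (Fin 3) L) : GL (Fin 3) ℂ) :
        Matrix (Fin 3) (Fin 3) ℂ) *ᵥ v))
    (inj₁ : Y₁ ⟶ (baseChangeHom τ).obj (S.M.obj K)) (inj₂ : Y₂ ⟶ (baseChangeHom τ).obj (S.M.obj K))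
    (h₁ : letI : Algebra L ℂ := τ.toAlgebra
      ∀ x : Ball, AlgPoints.map inj₁ (D₁.unif ((T : Matrix (Fin 3) (Fin 3) ℂ) *ᵥ BallModel.lift x)) =
        AlgPoints.baseChangeEquiv τ (S.M.obj K) ((S.pts K).symm (ShimuraSet.mk L H τ T hT K.1.1 x hh₁)))
    (h₂ : letI : Algebra L ℂ := τ.toAlgebra
      ∀ x : Ball, AlgPoints.map inj₂ (D₂.unif ((T : Matrix (Fin 3) (Fin 3) ℂ) *ᵥ BallModel.lift x)) =
        AlgPoints.baseChangeEquiv τ (S.M.obj K) ((S.pts K).symm (ShimuraSet.mk L H τ T hT K.1.1 x hh₂))) :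
    inj₁ = t ≫ inj₂ := by
  letI : Algebra L ℂ := τ.toAlgebra
  haveI := isSeparated_baseChange_record S K
  refine hom_ext_of_frame hT D₁ hD₁ fun x => ?_
  obtain ⟨k, hk, rfl⟩ := hrel
  -- `[x, h K] = [ρ(γ) • x, γ h k K]`
  have hx : ShimuraSet.mk L H τ T hT K.1.1 x hh₁ =
      ShimuraSet.mk L H τ T hT K.1.1 (ratToU21 L H τ T hT γ • x)
        (rationalToFinAdelic (↥(maximalRealSubfield L)) L (IsCMField.complexConj L) 3 H γ * hh₁ * k) := by
    refine (ShimuraSet.mk_eq_mk_iff L H τ T hT K.1.1 _ _ _ _).mpr ⟨γ⁻¹, ?_, ?_⟩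
    · rw [smul_smul, ← map_mul, inv_mul_cancel, map_one, one_smul]
    · have e : hh₁⁻¹ * (rationalToFinAdelic (↥(maximalRealSubfield L)) L (IsCMField.complexConj L) 3 H γ⁻¹ *
          (rationalToFinAdelic (↥(maximalRealSubfield L)) L (IsCMField.complexConj L) 3 H γ * hh₁ * k)) = k := by
        rw [map_inv]; group
      rw [e]; exact hk
  have hcone : (T : Matrix (Fin 3) (Fin 3) ℂ) *ᵥ BallModel.lift x ∈ D₁.cone := by
    change _ ∈ negCone D₁.Hℂ
    rw [hD₁]
    exact frame_mulVec_lift_mem_negCone hT x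
  have hcone' : (T : Matrix (Fin 3) (Fin 3) ℂ) *ᵥ BallModel.lift (ratToU21 L H τ T hT γ • x) ∈ D₂.cone := by
    change _ ∈ negCone D₂.Hℂ
    rw [hD₂]
    exact frame_mulVec_lift_mem_negCone hT _
  obtain ⟨c, hc, hcx⟩ := mulVec_frame_lift_ratToU21_smul (hT := hT) γ x
  rw [h₁, hx, AlgPoints.map_comp_apply, ht _ hcone, hcx, D₂.unif_smul hc hcone', h₂]

set_option maxHeartbeats 1600000 in -- large adelic / Shimura-set terms
/-- **Coherence along a Hecke translate** ([Milne2005ShimuraVarieties] §13 p. 118 L21–26 «`T(g) : [x, aK] ↦ [x, agK′]`»): for levels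
`K₁, K ≤ K₀`, `g` and ANY morphism `Tg : M_{K₁} ⟶ M_K` acting as `[z, aK₁] ↦ [z, agK]` (`RecordSystem.IsHeckeTranslate`; e.g. the translates of
the named fact `heckeTranslate_definedOver`, or the transition morphism at `g = 1`), component morphisms `inj₁` at `(K₁, h)` and `inj` at
`(K, hg)`, and ANY `t : Y₁ ⟶ Y` acting as `[v] ↦ [v]` (at the pin: `transMor 1`, the level `Γ_H(hK₁h⁻¹) ≤ Γ_H(hgKg⁻¹h⁻¹)`):
`inj₁ ≫ (Tg)_τ = t ≫ inj` ON THE NOSE. [cite: Milne2005ShimuraVarieties, §13 p. 118 L21–26 and Prop. 13.1 p. 117] [cite: Deligne1979ShimuraVarieties, 2.1.2–2.1.4] -/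
theorem componentMap_comp_heckeTranslate (S : RecordSystem L H τ T hT K₀) {K₁ K : C5.SmallLevel K₀}
    (g hh : finAdelic (↥(maximalRealSubfield L)) L (IsCMField.complexConj L) 3 H)
    {Tg : S.M.obj K₁ ⟶ S.M.obj K} (hTg : S.IsHeckeTranslate K₁ K g Tg)
    {Y₁ Y : SchemeOver ℂ} (D₁ : UnitaryBallUniformisationDatum 2 Y₁) (D : UnitaryBallUniformisationDatum 2 Y)
    (hD₁ : D₁.Hℂ = H.map τ) (t : Y₁ ⟶ Y) (ht : ∀ v ∈ D₁.cone, AlgPoints.map t (D₁.unif v) = D.unif v)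
    (inj₁ : Y₁ ⟶ (baseChangeHom τ).obj (S.M.obj K₁)) (inj : Y ⟶ (baseChangeHom τ).obj (S.M.obj K))
    (h₁ : letI : Algebra L ℂ := τ.toAlgebra
      ∀ x : Ball, AlgPoints.map inj₁ (D₁.unif ((T : Matrix (Fin 3) (Fin 3) ℂ) *ᵥ BallModel.lift x)) =
        AlgPoints.baseChangeEquiv τ (S.M.obj K₁) ((S.pts K₁).symm (ShimuraSet.mk L H τ T hT K₁.1.1 x hh)))
    (h₂ : letI : Algebra L ℂ := τ.toAlgebra
      ∀ x : Ball, AlgPoints.map inj (D.unif ((T : Matrix (Fin 3) (Fin 3) ℂ) *ᵥ BallModel.lift x)) =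
        AlgPoints.baseChangeEquiv τ (S.M.obj K) ((S.pts K).symm (ShimuraSet.mk L H τ T hT K.1.1 x (hh * g)))) :
    inj₁ ≫ (baseChangeHom τ).map Tg = t ≫ inj := by
  letI : Algebra L ℂ := τ.toAlgebra
  haveI := isSeparated_baseChange_record S K
  refine hom_ext_of_frame hT D₁ hD₁ fun x => ?_
  have hcone : (T : Matrix (Fin 3) (Fin 3) ℂ) *ᵥ BallModel.lift x ∈ D₁.cone := by
    change _ ∈ negCone D₁.Hℂ
    rw [hD₁]
    exact frame_mulVec_lift_mem_negCone hT x
  have hpt : AlgPoints.map Tg ((S.pts K₁).symm (ShimuraSet.mk L H τ T hT K₁.1.1 x hh)) =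
      (S.pts K).symm (ShimuraSet.mk L H τ T hT K.1.1 x (hh * g)) := by
    apply (S.pts K).injective
    rw [hTg x hh, Homeomorph.apply_symm_apply]
  rw [AlgPoints.map_comp_apply, h₁, ← AlgPoints.baseChangeEquiv_map, hpt, AlgPoints.map_comp_apply, ht _ hcone, h₂]

/-- **Coherence along the transition morphisms** `M_K ⟶ M_{K'}` (`K ≤ K'`; [Deligne1979ShimuraVarieties] 2.1.4 `[z, aK] ↦ [z, aK']`, the
record field `map_pts`): `inj ≫ (M.map f)_τ = t ≫ inj'` for component morphisms at `(K, h)`, `(K', h)` and any `t` acting as `[v] ↦ [v]` —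
the case `g = 1` of `componentMap_comp_heckeTranslate` (`RecordSystem.isHeckeTranslate_one_map`). [cite: Deligne1979ShimuraVarieties, 2.1.4] [cite: Milne2005ShimuraVarieties, §5 p. 58 L3–6] -/
theorem componentMap_comp_map (S : RecordSystem L H τ T hT K₀) {K K' : C5.SmallLevel K₀} (f : K ⟶ K')
    (hh : finAdelic (↥(maximalRealSubfield L)) L (IsCMField.complexConj L) 3 H)
    {Y Y' : SchemeOver ℂ} (D : UnitaryBallUniformisationDatum 2 Y) (D' : UnitaryBallUniformisationDatum 2 Y')
    (hD : D.Hℂ = H.map τ) (t : Y ⟶ Y') (ht : ∀ v ∈ D.cone, AlgPoints.map t (D.unif v) = D'.unif v)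
    (inj : Y ⟶ (baseChangeHom τ).obj (S.M.obj K)) (inj' : Y' ⟶ (baseChangeHom τ).obj (S.M.obj K'))
    (h₁ : letI : Algebra L ℂ := τ.toAlgebra
      ∀ x : Ball, AlgPoints.map inj (D.unif ((T : Matrix (Fin 3) (Fin 3) ℂ) *ᵥ BallModel.lift x)) =
        AlgPoints.baseChangeEquiv τ (S.M.obj K) ((S.pts K).symm (ShimuraSet.mk L H τ T hT K.1.1 x hh)))
    (h₂ : letI : Algebra L ℂ := τ.toAlgebra
      ∀ x : Ball, AlgPoints.map inj' (D'.unif ((T : Matrix (Fin 3) (Fin 3) ℂ) *ᵥ BallModel.lift x)) =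
        AlgPoints.baseChangeEquiv τ (S.M.obj K') ((S.pts K').symm (ShimuraSet.mk L H τ T hT K'.1.1 x hh))) :
    inj ≫ (baseChangeHom τ).map (S.M.map f) = t ≫ inj' := by
  refine componentMap_comp_heckeTranslate S 1 hh (S.isHeckeTranslate_one_map f) D D' hD t ht inj inj' h₁ ?_
  simpa only [mul_one] using h₂

end Record

end Summit.HodgeConjecture.CorCM.D2Bridge

end
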